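import Mathlib.Analysis.SpecialFunctions.Log.Basic
import Mathlib.MeasureTheory.Integral.Bochner.Basic
import HarnessLib

/-!
# Gibbs' variational inequality (non-negativity of the relative entropy w.r.t. a Gibbs measure)

For a measure `μ`, a probability density `ρ ≥ 0` (`∫ ρ dμ = 1`) and a potential `V` with finite
partition function `Z := ∫ e^{-V} dμ` we prove

  `-∫ ρ log ρ dμ ≤ ∫ V ρ dμ + log Z`

(`neg_integral_mul_log_le_integral_mul_add_log_integral_exp_neg`, and the registered form
`Literature.Geometry.Riemannian.neg_integral_mul_log_le_integral_mul_add_log`). This is the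
Gibbs variational principle — the Gibbs density `e^{-V}/Z` minimises the free energy
`∫ V ρ dμ + ∫ ρ log ρ dμ`, whose minimum is `-log Z` — equivalently the non-negativity of the
relative entropy of the probability measure `ρ μ` with respect to the Gibbs probability measure
`Z⁻¹ e^{-V} μ`: `0 ≤ KL(ρμ ‖ Z⁻¹e^{-V}μ) = ∫ ρ log ρ dμ + ∫ V ρ dμ + log Z` (Gibbs' inequality,
the "information inequality" `D(p ‖ q) ≥ 0`). The case `V = 0` on a finite measure is the entropy
bound `-∫ ρ log ρ dμ ≤ log μ(univ)` of `Literature.MeasureTheory.Jensen.EntropyBound`.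

No σ-finiteness or measurability of `V` beyond the stated integrability hypotheses is needed, and
`Z > 0` is automatic (`μ ≠ 0` because `∫ ρ dμ = 1`).

## Proof

Pointwise (`neg_mul_log_sub_mul_sub_mul_log_le`), by the elementary inequality `log t ≤ t - 1` at
`t = e^{-V}/(Z ρ)` where `ρ > 0` (and trivially where `ρ = 0`):

  `-ρ log ρ - V ρ - ρ log Z = ρ log (e^{-V}/(Z ρ)) ≤ ρ (e^{-V}/(Z ρ) - 1) = e^{-V}/Z - ρ`;

integrating (all terms are integrable by hypothesis), the right-hand side has integral
`Z/Z - 1 = 0`, which is the claim.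

## References

* T. M. Cover, J. A. Thomas, *Elements of Information Theory*, 2nd ed., Wiley 2006, Thm. 2.6.3
  (information inequality `D(p ‖ q) ≥ 0`, from `log t ≤ t - 1` / Jensen) and §8.6 (relative
  entropy of densities). [CoverThomas2006]
-/

noncomputable section

open MeasureTheory Set Real Filter

namespace Literature.MeasureTheory.Jensen

variable {X : Type*} [MeasurableSpace X] {μ : Measure X}

/-- **Pointwise Gibbs inequality.** For `0 ≤ r`, `0 < Z` and any real `v`:
`-r log r - v r - r log Z ≤ e^{-v}/Z - r`. For `r > 0` this is `log t ≤ t - 1` at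
`t = e^{-v}/(Z r)` multiplied by `r`; for `r = 0` the left-hand side vanishes.
[cite: CoverThomas2006, Thm. 2.6.3] -/
theorem neg_mul_log_sub_mul_sub_mul_log_le {r v Z : ℝ} (hr : 0 ≤ r) (hZ : 0 < Z) :
    -(r * log r) - v * r - r * log Z ≤ exp (-v) / Z - r := by
  rcases hr.eq_or_lt with h | h
  · rw [← h]
    have : 0 ≤ exp (-v) / Z := div_nonneg (exp_pos _).le hZ.le
    simpa using this
  · have hZr : 0 < Z * r := mul_pos hZ h
    have ht : 0 < exp (-v) / (Z * r) := div_pos (exp_pos _) hZr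
    have hlog : log (exp (-v) / (Z * r)) = -v - log Z - log r := by
      rw [log_div (exp_pos _).ne' hZr.ne', log_exp, log_mul hZ.ne' h.ne']
      ring
    have h2 : r * (-v - log Z - log r) ≤ r * (exp (-v) / (Z * r) - 1) := by
      rw [← hlog]
      exact mul_le_mul_of_nonneg_left (log_le_sub_one_of_pos ht) hr
    have h3 : r * (exp (-v) / (Z * r) - 1) = exp (-v) / Z - r := by
      field_simp
    calc -(r * log r) - v * r - r * log Z = r * (-v - log Z - log r) := by ring
      _ ≤ r * (exp (-v) / (Z * r) - 1) := h2
      _ = exp (-v) / Z - r := h3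

/-- **Gibbs' variational inequality** (non-negativity of the relative entropy with respect to a
Gibbs measure). Let `μ` be a measure, `ρ ≥ 0` a.e. an integrable density with `∫ ρ dμ = 1` and
`ρ log ρ` integrable, and `V` a potential with `V ρ` and `e^{-V}` integrable. Then
`-∫ ρ log ρ dμ ≤ ∫ V ρ dμ + log (∫ e^{-V} dμ)`, i.e. `0 ≤ KL(ρ μ ‖ Z⁻¹ e^{-V} μ)` with
`Z = ∫ e^{-V} dμ`. [cite: CoverThomas2006, Thm. 2.6.3] -/
theorem neg_integral_mul_log_le_integral_mul_add_log_integral_exp_neg {ρ V : X → ℝ}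
    (hρ : Integrable ρ μ) (hρ0 : 0 ≤ᵐ[μ] ρ) (hρ1 : ∫ x, ρ x ∂μ = 1)
    (hρlog : Integrable (fun x ↦ ρ x * Real.log (ρ x)) μ)
    (hVρ : Integrable (fun x ↦ V x * ρ x) μ) (hZ : Integrable (fun x ↦ Real.exp (-V x)) μ) :
    -∫ x, ρ x * Real.log (ρ x) ∂μ ≤
      ∫ x, V x * ρ x ∂μ + Real.log (∫ x, Real.exp (-V x) ∂μ) := by
  haveI hμ : NeZero μ := ⟨fun h ↦ by simp [h] at hρ1⟩
  set Z := ∫ x, exp (-V x) ∂μ with hZdef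
  have hZpos : 0 < Z := integral_exp_pos hZ
  -- the pointwise inequality, a.e.
  have hpt : ∀ᵐ x ∂μ,
      -(ρ x * log (ρ x)) - V x * ρ x - ρ x * log Z ≤ exp (-V x) / Z - ρ x := by
    filter_upwards [hρ0] with x hx using neg_mul_log_sub_mul_sub_mul_log_le hx hZpos
  have hlhs : Integrable (fun x ↦ -(ρ x * log (ρ x)) - V x * ρ x - ρ x * log Z) μ :=
    (hρlog.neg.sub hVρ).sub (hρ.mul_const _)
  have hrhs : Integrable (fun x ↦ exp (-V x) / Z - ρ x) μ := (hZ.div_const _).sub hρ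
  have hint := integral_mono_ae hlhs hrhs hpt
  -- evaluate both integrals
  have h1 : Integrable (fun x ↦ -(ρ x * log (ρ x)) - V x * ρ x) μ := hρlog.neg.sub hVρ
  have h2 : Integrable (fun x ↦ ρ x * log Z) μ := hρ.mul_const _
  have h3 : Integrable (fun x ↦ -(ρ x * log (ρ x))) μ := hρlog.neg
  have h4 : Integrable (fun x ↦ exp (-V x) / Z) μ := hZ.div_const _
  have hL : ∫ x, (-(ρ x * log (ρ x)) - V x * ρ x - ρ x * log Z) ∂μ
      = -∫ x, ρ x * log (ρ x) ∂μ - ∫ x, V x * ρ x ∂μ - log Z := by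
    rw [integral_sub h1 h2, integral_sub h3 hVρ, integral_neg, integral_mul_const, hρ1, one_mul]
  have hR : ∫ x, (exp (-V x) / Z - ρ x) ∂μ = 0 := by
    rw [integral_sub h4 hρ, integral_div, hρ1, ← hZdef, div_self hZpos.ne', sub_self]
  rw [hL, hR] at hint
  linarith

/-- **Gibbs' variational inequality**, relative-entropy form: under the hypotheses of
`neg_integral_mul_log_le_integral_mul_add_log_integral_exp_neg`,
`0 ≤ ∫ ρ log ρ dμ + ∫ V ρ dμ + log (∫ e^{-V} dμ)` (`= KL(ρ μ ‖ Z⁻¹ e^{-V} μ)`).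
[cite: CoverThomas2006, Thm. 2.6.3] -/
theorem integral_mul_log_add_integral_mul_add_log_integral_exp_neg_nonneg {ρ V : X → ℝ}
    (hρ : Integrable ρ μ) (hρ0 : 0 ≤ᵐ[μ] ρ) (hρ1 : ∫ x, ρ x ∂μ = 1)
    (hρlog : Integrable (fun x ↦ ρ x * Real.log (ρ x)) μ)
    (hVρ : Integrable (fun x ↦ V x * ρ x) μ) (hZ : Integrable (fun x ↦ Real.exp (-V x)) μ) :
    0 ≤ ∫ x, ρ x * Real.log (ρ x) ∂μ + ∫ x, V x * ρ x ∂μ +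
      Real.log (∫ x, Real.exp (-V x) ∂μ) := by
  have := neg_integral_mul_log_le_integral_mul_add_log_integral_exp_neg hρ hρ0 hρ1 hρlog hVρ hZ
  linarith

end Literature.MeasureTheory.Jensen

namespace Literature.Geometry.Riemannian

/-- **Gibbs' variational inequality** (registered form, used with `μ = dV_g`, `ρ` a conjugate
heat kernel density and `V = d(z, ·)²/(2σ²)` to bound a Nash entropy by a Gaussian entropy).
For a measure `μ`, a density `ρ ≥ 0` with `∫ ρ dμ = 1` and `ρ log ρ` integrable, and a measurable
potential `V` with `V ρ` and `e^{-V}` integrable: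
`-∫ ρ log ρ dμ ≤ ∫ V ρ dμ + log (∫ e^{-V} dμ)`. (The measurability hypothesis on `V` is not used.)
[cite: CoverThomas2006, Thm. 2.6.3] -/
theorem neg_integral_mul_log_le_integral_mul_add_log {X : Type*} [MeasurableSpace X]
    (μ : Measure X) {ρ V : X → ℝ} (hρ : Integrable ρ μ) (hρ0 : ∀ x, 0 ≤ ρ x)
    (hρ1 : ∫ x, ρ x ∂μ = 1)
    (hρlog : Integrable (fun x ↦ ρ x * Real.log (ρ x)) μ) (_hV : Measurable V)
    (hVρ : Integrable (fun x ↦ V x * ρ x) μ) (hZ : Integrable (fun x ↦ Real.exp (-V x)) μ) :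
    -∫ x, ρ x * Real.log (ρ x) ∂μ ≤
      ∫ x, V x * ρ x ∂μ + Real.log (∫ x, Real.exp (-V x) ∂μ) :=
  Literature.MeasureTheory.Jensen.neg_integral_mul_log_le_integral_mul_add_log_integral_exp_neg
    hρ (Eventually.of_forall hρ0) hρ1 hρlog hVρ hZ

end Literature.Geometry.Riemannian

end
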